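import Literature.MathematicalPhysics.KineticTheory.RiemannLocalGibbsExistence
import Mathlib.MeasureTheory.Measure.Haar.InnerProductSpace
import HarnessLib

/-!
# Existence and uniqueness of the Riemann local Gibbs law at small activity: the discharge

Topic `Literature/MathematicalPhysics/KineticTheory`; PROOFS (no definitions, no named facts).
DISCHARGES the named fact
`Literature.MathematicalPhysics.KineticTheory.RiemannLocalGibbsExistsUnique` of
`RiemannLocalGibbsLaw.lean` as `RiemannLocalGibbsExistsUnique_holds`, with the absolute constant
`c₀ = 1/32`: for a Riemann datum `D` with `σ > 0`, `θ± > 0`, `z± ≥ 0` and `max(z₋,z₊) σ³ ≤ 1/32`,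
the DLR equations `IsRiemannLocalGibbs D` have exactly one solution.

The general theorems `exists_isHsLocalGibbs_of_small_activity` (existence, file
`RiemannLocalGibbsExistence`) and `IsHsLocalGibbs.unique_of_small_activity` (uniqueness, file
`RiemannLocalGibbsUniqueness`) apply to the Riemann intensity `ν_D = z(q) dq M_{u(q),θ(q)}(dv)`:
it is locally finite and atomless (tree), charges no hyperplane `{q₁ = t}` (Lebesgue), gives
finite mass `≤ max(z₋,z₊) |B(0,R)|` to the window of every ball, and mass
`≤ κ = 8 max(z₋,z₊) σ³` to every ball window `B(q,σ) × ℝ³` (a ball lies in a cube of side `2σ`),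
so that `2κ ≤ 16/32 < 1`.  The whole proof follows Michelen–Perkins (arXiv:2109.01094): the
first-point (GNZ/Mecke) recursion for the finite-volume quantities with modified boundary data,
its contraction at small activity, uniqueness from the resulting uniform decay of the boundary
influence, and existence by the thermodynamic limit of the free finite-volume distributions
(consistency + the same decay), assembled on locally finite configurations by Ionescu-Tulcea.

## References

* M. Michelen, W. Perkins, *Potential-weighted connective constants and uniqueness of Gibbs
  measures*, arXiv:2109.01094 (Comm. Math. Phys. 399 (2023)), Thm 3, Thm 25. [MichelenPerkins2021]
* H.-O. Georgii, *Gibbs Measures and Phase Transitions* (2011), Def. 1.23, §4.4. [Georgii2011]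
-/

noncomputable section

open MeasureTheory ProbabilityTheory Set Filter
open scoped ENNReal NNReal Topology

namespace Literature.MathematicalPhysics.KineticTheory

open Literature.Analysis.FunctionSpaces
open Literature.MathematicalPhysics.StatisticalMechanics
open Literature.MathematicalPhysics.StatisticalMechanics.HardSphere (Pos Phase window hardCoreSet
  glue poissonLaw maxwellian IsHardCore)

/-! ### Geometry of `ℝ³`: hyperplanes are null, balls lie in cubes -/

/-- The coordinate hyperplanes `{q₁ = t}` of `ℝ³` are Lebesgue null. [folklore] -/
theorem volume_setOf_apply_zero_eq (t : ℝ) : volume {q : Pos | q 0 = t} = 0 := by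
  have h : {q : Pos | q 0 = t} = (WithLp.ofLp : Pos → Fin 3 → ℝ) ⁻¹' {f | f 0 = t} := rfl
  rw [h, (PiLp.volume_preserving_ofLp (Fin 3)).measure_preimage
    ((measurableSet_eq_fun (measurable_pi_apply 0) measurable_const).nullMeasurableSet),
    MeasureTheory.volume_pi]
  exact Measure.pi_hyperplane (fun _ : Fin 3 => (volume : Measure ℝ)) 0 t

/-- A ball of radius `σ` in `ℝ³` has volume at most `(2σ)³` (it lies in a cube of side `2σ`).
[folklore] -/
theorem volume_ball_le (a : Pos) (σ : ℝ) : volume (Metric.ball a σ) ≤ ENNReal.ofReal (2 * σ) ^ 3 := by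
  have hsub : Metric.ball a σ ⊆ (WithLp.ofLp : Pos → Fin 3 → ℝ) ⁻¹'
      Icc (fun i => a i - σ) (fun i => a i + σ) := by
    intro q hq
    rw [Metric.mem_ball, dist_eq_norm] at hq
    simp only [mem_preimage, mem_Icc, Pi.le_def]
    have hi : ∀ i, |q i - a i| < σ := fun i =>
      lt_of_le_of_lt (by simpa using PiLp.norm_apply_le (q - a) i) hq
    exact ⟨fun i => by have := (abs_lt.1 (hi i)).1; change a i - σ ≤ q i; linarith,
      fun i => by have := (abs_lt.1 (hi i)).2; change q i ≤ a i + σ; linarith⟩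
  calc volume (Metric.ball a σ) ≤ volume ((WithLp.ofLp : Pos → Fin 3 → ℝ) ⁻¹'
        Icc (fun i => a i - σ) (fun i => a i + σ)) := measure_mono hsub
    _ = volume (Icc (fun i : Fin 3 => a i - σ) (fun i => a i + σ)) :=
        (PiLp.volume_preserving_ofLp (Fin 3)).measure_preimage measurableSet_Icc.nullMeasurableSet
    _ = ENNReal.ofReal (2 * σ) ^ 3 := by
        rw [Real.volume_Icc_pi]
        simp only [add_sub_sub_cancel, Finset.prod_const, Finset.card_univ, Fintype.card_fin]
        rw [← two_mul]

/-! ### The Riemann intensity satisfies the hypotheses of the general theorems -/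

namespace RiemannDatum

variable (D : RiemannDatum)

/-- The intensity of a window: `ν_D(A × ℝ³) = z₋ |A ∩ {q₁<0}| + z₊ |A ∩ {q₁ ≥ 0}|`. [folklore] -/
theorem intensity_window (A : Set Pos) (hA : MeasurableSet A) :
    D.intensity (window A) = ENNReal.ofReal D.zL * volume (A ∩ leftHalf) +
      ENNReal.ofReal D.zR * volume (A ∩ rightHalf) := by
  rw [window, intensity, Measure.add_apply, HardSphere.intensity_prod _ _ hA,
    HardSphere.intensity_prod _ _ hA]
  simp [leftParams, rightParams]

/-- **The intensity of a window is at most `max(z₋, z₊)` times its volume.** [folklore] -/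
theorem intensity_window_le (A : Set Pos) (hA : MeasurableSet A) :
    D.intensity (window A) ≤ ENNReal.ofReal (max D.zL D.zR) * volume A := by
  rw [D.intensity_window A hA]
  calc ENNReal.ofReal D.zL * volume (A ∩ leftHalf) + ENNReal.ofReal D.zR * volume (A ∩ rightHalf)
      ≤ ENNReal.ofReal (max D.zL D.zR) * volume (A ∩ leftHalf) +
          ENNReal.ofReal (max D.zL D.zR) * volume (A ∩ rightHalf) := by
        gcongr
        · exact le_max_left _ _
        · exact le_max_right _ _
    _ = ENNReal.ofReal (max D.zL D.zR) * volume A := by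
        rw [← mul_add, ← measure_union (disjoint_leftHalf_rightHalf.mono inter_subset_right
          inter_subset_right) (hA.inter measurableSet_rightHalf), ← inter_union_distrib_left,
          leftHalf_union_rightHalf, inter_univ]

/-- The Riemann intensity charges no hyperplane `{q₁ = t}`. [folklore] -/
theorem intensity_setOf_fst_apply_zero_eq (t : ℝ) : D.intensity {y : Phase | y.1 0 = t} = 0 := by
  have h : {y : Phase | y.1 0 = t} = window {q : Pos | q 0 = t} := by
    ext y; simp [HardSphere.mem_window]
  rw [h]
  refine nonpos_iff_eq_zero.1 ((D.intensity_window_le _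
    (measurableSet_eq_fun measurable_apply_zero measurable_const)).trans ?_)
  rw [volume_setOf_apply_zero_eq, mul_zero]

/-- The Riemann intensity of the window of a ball is finite. [folklore] -/
theorem intensity_window_ball_ne_top (a : Pos) (R : ℝ) : D.intensity (window (Metric.ball a R)) ≠ ∞ :=
  ne_top_of_le_ne_top (ENNReal.mul_ne_top ENNReal.ofReal_ne_top
    Metric.isBounded_ball.measure_lt_top.ne)
    (D.intensity_window_le _ Metric.isOpen_ball.measurableSet)

/-- **The Riemann intensity of a ball window `B(a,σ) × ℝ³` is at most `8 max(z₋,z₊) σ³`.**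
[folklore] -/
theorem intensity_window_ball_le (hz : 0 ≤ max D.zL D.zR) (hσ : 0 ≤ D.σ) (a : Pos) :
    D.intensity (window (Metric.ball a D.σ)) ≤ ENNReal.ofReal (max D.zL D.zR * (8 * D.σ ^ 3)) := by
  refine (D.intensity_window_le _ Metric.isOpen_ball.measurableSet).trans ?_
  rw [ENNReal.ofReal_mul hz]
  gcongr
  calc volume (Metric.ball a D.σ) ≤ ENNReal.ofReal (2 * D.σ) ^ 3 := volume_ball_le a D.σ
    _ = ENNReal.ofReal (8 * D.σ ^ 3) := by
        rw [← ENNReal.ofReal_pow (by linarith)]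
        congr 1; ring

end RiemannDatum

/-! ### The discharge -/

/-- **Existence and uniqueness of the Riemann local Gibbs law at small activity** — discharge of
the named fact `RiemannLocalGibbsExistsUnique` with the absolute constant `c₀ = 1/32`: for every
Riemann datum with `σ > 0`, `θ₋, θ₊ > 0`, `z₋, z₊ ≥ 0` and `max(z₋, z₊) σ³ ≤ 1/32`, the DLR
equations of the hard-sphere gas with the half-space-wise constant activity and Maxwellian velocity
marks (`IsRiemannLocalGibbs D`) have exactly one solution.  Existence:
`exists_isHsLocalGibbs_of_small_activity`; uniqueness: `IsHsLocalGibbs.unique_of_small_activity`;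
both for the Riemann intensity with `κ = 8 max(z₋,z₊) σ³ ≤ 1/4`, so `2κ < 1` (Michelen–Perkins'
method: GNZ/Mecke first-point recursion, contraction, decay of the boundary influence,
thermodynamic limit). [cite: MichelenPerkins2021, Thm 3 and Thm 25] -/
theorem RiemannLocalGibbsExistsUnique_holds : RiemannLocalGibbsExistsUnique := by
  refine ⟨1 / 32, by norm_num, fun D hσ _ _ hzL hzR hsmall => ?_⟩
  set z : ℝ := max D.zL D.zR with hz
  have hz0 : 0 ≤ z := le_trans hzL (le_max_left _ _)
  set κ : ℝ := z * (8 * D.σ ^ 3) with hκdef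
  have hκ0 : 0 ≤ κ := by positivity
  have hκ1 : 2 * κ < 1 := by
    have : z * D.σ ^ 3 ≤ 1 / 32 := hsmall
    rw [hκdef]; nlinarith
  have h0 : ∀ x, D.intensity {x} = 0 := D.intensity_singleton
  have hm : ∀ t : ℝ, D.intensity {y : Phase | y.1 0 = t} = 0 := D.intensity_setOf_fst_apply_zero_eq
  have hκ : ∀ a : Pos, D.intensity (window (Metric.ball a D.σ)) ≤ ENNReal.ofReal κ :=
    fun a => D.intensity_window_ball_le hz0 hσ.le a
  have hfin : ∀ R : ℝ, D.intensity (window (Metric.ball (0 : Pos) R)) ≠ ∞ :=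
    fun R => D.intensity_window_ball_ne_top 0 R
  obtain ⟨μ, hμ⟩ := exists_isHsLocalGibbs_of_small_activity D.intensity hσ h0 hm hκ0 hκ hκ1 hfin
  exact ⟨μ, hμ, fun μ' hμ' =>
    IsHsLocalGibbs.unique_of_small_activity D.intensity hσ h0 hm hκ0 hκ hκ1 hfin hμ' hμ⟩

end Literature.MathematicalPhysics.KineticTheory

end
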